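import Literature.AlgebraicGeometry.Resolution.PermissibleBlowupHilbertSamuelLocal
import Literature.AlgebraicGeometry.Resolution.PermissibleCentres
import Literature.AlgebraicGeometry.Resolution.BlowupStalkCharts
import Literature.AlgebraicGeometry.Resolution.BlowupsFlatBaseChange
import Literature.AlgebraicGeometry.Resolution.PointBlowupHilbertSamuelStrata
import Literature.AlgebraicGeometry.Resolution.HilbertSamuelLocal
import Literature.AlgebraicGeometry.Resolution.RegularLocalRingsProofs
import HarnessLib

/-!
# `H_{X'}(x') ≤ H_X(π x')` for the blow-up of an excellent scheme in a permissible centre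
# (Cossart–Jannsen–Saito 2020, Thm. 3.10 (1); Bennett, Hironaka, Singh)

Topic: `Literature/AlgebraicGeometry/Resolution`. The scheme-level assembly of
`PermissibleBlowupHilbertSamuelLocal.lean`: for `π : X' → X` a blow-up of a locally Noetherian
scheme `X` in a centre `D` which is permissible at `π x'` (CJS Def. 3.1: `D` regular at `π x'`, `X`
normally flat along `D` at `π x'`), with `𝒪_{X,π x'}` universally catenary (e.g. `X` excellent),
**`H^N_{X'}(x') ≤ H^N_X(π x')` for every `N`** (`Scheme.hsFun`, CJS Def. 2.28) — at EVERY point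
`x'` (closed in its fibre or not; off `π⁻¹(D)` the blow-up is a local isomorphism) and in EVERY
characteristic. The local rings of `X'` at points over `x` are the localizations `(B_j)_𝔴` of the
charts `B_j = 𝒪_{X,x}[J_x/c_j]` (`IsBlowup.exists_reesChart_stalk`), to which the ring-level
theorem `hilbertSamuelFun_sub_minimalPrimesCodim_le_of_isPermissible` applies.

* `IsBlowup.hsFun_le_of_isPermissibleAt` — at a point over a permissible point of the centre;
* `IsBlowup.hsFun_le_of_not_mem_support` — off the centre (equality);
* `IsBlowup.hsFun_le_of_isPermissible` — **CJS Thm. 3.10 (1), third inequality**, for a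
  permissible centre of an excellent scheme, at every point.

This discharges the named fact `CossartJannsenSaito2020_thm_3_10_1`
(`PermissibleBlowupHsFunMono.lean`). No named facts are introduced.

## Sources

* V. Cossart, U. Jannsen, S. Saito, LNM 2270 (2020), Thm. 3.10 (1), Def. 2.28, Def. 3.1.
  [CossartJannsenSaito2020]
* M. Herrmann, S. Ikeda, U. Orbanz (1988), Thm. (31.1), Cor. (31.2). [HerrmannIkedaOrbanz1988]
* The Stacks Project, Tags 0804, 02OS. [StacksProject]
-/

noncomputable section

open CategoryTheory AlgebraicGeometry TopologicalSpace IsLocalRing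
open Literature.RingTheory.HilbertSamuel

namespace Literature.AlgebraicGeometry.Resolution

universe u

variable {X X' : Scheme.{u}} {π : X' ⟶ X} {D : X.IdealSheafData}

/-- **CJS Thm. 3.10 (1), third inequality, at a point over a permissible point of the centre.**
Let `X` be locally Noetherian, `π : X' → X` a blow-up in `D`, `x' ∈ X'` with `π x' ∈ D`, `D`
permissible at `π x'` and `𝒪_{X,π x'}` universally catenary. Then `H^N_{X'}(x') ≤ H^N_X(π x')`
for every `N`. [cite: CossartJannsenSaito2020, Thm. 3.10 (1)]
[cite: HerrmannIkedaOrbanz1988, Cor. (31.2) (c)] -/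
theorem IsBlowup.hsFun_le_of_isPermissibleAt [IsLocallyNoetherian X] (hπ : IsBlowup π D)
    (x' : X') (hperm : IdealSheafData.IsPermissibleAt D (π.base x'))
    (hUC : IsUniversallyCatenaryRing (X.presheaf.stalk (π.base x'))) (N : ℕ) :
    Scheme.hsFun X' N x' ≤ Scheme.hsFun X N (π.base x') := by
  classical
  obtain ⟨k, c, hc⟩ := Submodule.fg_iff_exists_fin_generating_family.mp
    (IsNoetherian.noetherian (stalkIdeal D (π.base x')))
  obtain ⟨j, 𝔴, χ, hχ, hloc, h𝔴⟩ := hπ.exists_reesChart_stalk x' c hc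
  letI algCO : Algebra (chartRing c j) (X'.presheaf.stalk x') := χ.toAlgebra
  letI algRO : Algebra (X.presheaf.stalk (π.base x')) (X'.presheaf.stalk x') :=
    (π.stalkMap x').hom.toAlgebra
  haveI : IsLocalization.AtPrime (X'.presheaf.stalk x') 𝔴.asIdeal := hloc
  -- permissibility of `J_x = (c_1, …, c_k)`
  have hc' : Ideal.span (Set.range c) = stalkIdeal D (π.base x') := hc
  have hp : (Ideal.span (Set.range c)).IsPermissible := by
    rw [hc']; exact hperm
  haveI : IsRegularLocalRing (X.presheaf.stalk (π.base x') ⧸ Ideal.span (Set.range c)) := hp.1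
  haveI : IsDomain (X.presheaf.stalk (π.base x') ⧸ Ideal.span (Set.range c)) :=
    isDomain_of_isRegularLocalRing _
  haveI : (Ideal.span (Set.range c)).IsPrime :=
    (Ideal.Quotient.isDomain_iff_prime _).mp inferInstance
  have hOO' : ∀ r : X.presheaf.stalk (π.base x'),
      algebraMap (X.presheaf.stalk (π.base x')) (X'.presheaf.stalk x') r =
        (algebraMap (chartRing c j) (X'.presheaf.stalk x') :
          chartRing c j →+* X'.presheaf.stalk x') (chartBase c j r) :=
    fun r => (hχ r).symm
  have key := hilbertSamuelFun_sub_minimalPrimesCodim_le_of_isPermissible c j 𝔴.asIdeal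
    (X'.presheaf.stalk x') hUC hp.2.1 h𝔴 hOO' N
  rw [Scheme.hsFun_def, Scheme.hsFun_def]
  exact key

/-- **Off the centre the Hilbert–Samuel function does not change**: `H^N_{X'}(x') = H^N_X(π x')`
for `π x' ∉ D` (the blow-up is an isomorphism over `X ∖ D`, Stacks 02OS).
[cite: StacksProject, Tag 02OS] [cite: CossartJannsenSaito2020, Def. 2.28] -/
theorem IsBlowup.hsFun_eq_of_not_mem_support [IsLocallyNoetherian X] (hπ : IsBlowup π D)
    (x' : X') (hx' : π.base x' ∉ D.support) (N : ℕ) :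
    Scheme.hsFun X' N x' = Scheme.hsFun X N (π.base x') := by
  haveI := hπ.isIso_compl
  haveI : IsIso (π.stalkMap x') :=
    isIso_stalkMap_of_isIso_morphismRestrict π ⟨(D.support : Set X)ᶜ, D.support.isClosed.isOpen_compl⟩
      x' hx'
  exact Scheme.hsFun_eq_of_isIso_stalkMap π N x'

/-- **Cossart–Jannsen–Saito 2020, Thm. 3.10 (1), third inequality (Bennett–Hironaka–Singh):
`H^N_{X'}(x') ≤ H^N_X(π x')` for the blow-up `π : X' → X` of an excellent scheme `X` in a
permissible centre `D`, at every point `x' ∈ X'` and for every `N`.**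
[cite: CossartJannsenSaito2020, Thm. 3.10 (1)] [cite: HerrmannIkedaOrbanz1988, Cor. (31.2) (c)] -/
theorem IsBlowup.hsFun_le_of_isPermissible [IsLocallyNoetherian X] (hπ : IsBlowup π D)
    (hX : Scheme.IsExcellent X) (hD : IdealSheafData.IsPermissible D) (N : ℕ) (x' : X') :
    Scheme.hsFun X' N x' ≤ Scheme.hsFun X N (π.base x') := by
  by_cases hx : π.base x' ∈ D.support
  · exact hπ.hsFun_le_of_isPermissibleAt x' (hD _ hx) (hX.isUniversallyCatenaryRing_stalk _) N
  · exact (hπ.hsFun_eq_of_not_mem_support x' hx N).le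

end Literature.AlgebraicGeometry.Resolution

end
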